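import Summits.CriticalPhenomena.CardyFormulaZ2.Theorems.CardySusyWardWeakHolomorphyKirchhoffIdentity

/-! # The full node template at spin `1/3` (pairing helper): arriving darts weigh `(2 + λ^{2s}) λ^C` per once/twice pair

Line `Sketch` of the crux `CardySusyWard.WeakHolomorphy` (stmt-CriticalPhenomena-11292), lead c3 (infrastructure,
`--supports`).  The landed Kirchhoff identity (`stub_kirchhoffIdentity`, p114738) gives ONE complex combination of the four
dart observables at an interior medial vertex `z` in terms of the once-visit chiral sums `Z_L, Z_R` (`onceChiralObs`).
Here the SAME once/twice pairing (`cornerOrbit_toggle_case1`, the weights of `kval_case1`) is read for the ARRIVING darts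
alone: per pair {once-visit with arrival weight `λ^C` and turn `s`, its flip (a twice-visit: arrivals `λ^C`, `λ^{C+2s}`)}
the two arriving dart weights add up to `(2 + λ^{2s}) λ^C`, `λ = e^{-iπ/6}` (`ival_case1`, `ival_pair_of_once`; this
file).  The integrated identities `F(in₁) + F(in₂) = (2 + λ²) Z_L + (2 + λ̄²) Z_R` and
`F(out₁) + F(out₂) = (2λ + λ̄) Z_L + (2λ̄ + λ) Z_R` are assembled in `…WeakHolomorphyInTemplate.lean`: ALL vertex-summed
statistics of the spin-`1/3` dart observable at `z` are functions of `(Z_L, Z_R)`.  Reading: the `2` is the first-arrival phase counted on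
both members of a pair (the FIRST-ARRIVAL phase sum at `z` is exactly `2 (Z_L + Z_R)`, i.e. given the past up to the
first arrival the vertex is visited exactly once with probability `1/2`), the `λ^{±2}` the rigid second arrival of the
twice-visit.  References: Duminil-Copin–Smirnov arXiv:1109.1549 §8.3; Duminil-Copin arXiv:1208.3787 Prop. 4;
Zhou arXiv:2409.03235 §4 eq. (102); crux workfile `Cruxes/WeakHolomorphy/Lines/Sketch.md` (node template).
-/

noncomputable section

namespace Summit.CriticalPhenomena.CardyFormulaZ2.Theorems.WeakHolomorphy.SplitBypass

open scoped BigOperators symmDiff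
open MeasureTheory
open _root_.Literature.Probability.LatticeModels
open _root_.Literature.Probability.Percolation (BondConfig bondPercolation half)
open _root_.Literature.Barriers.CriticalPhenomena (medialCornersAt medialVertexOf)
open Summit.CriticalPhenomena.CardyFormulaZ2.Theorems.ParafermionFamiliesToSLESix.StripAnchored.S2
  (dartW sixthPhase sixthPhase_add dartW_eq_zero dartW_eq_single loopTurn_eq one_of_both turnSign_partner)
open Summit.CriticalPhenomena.CardyFormulaZ2.Cruxes.ParafermionPrecompact.KenyonStreamSecondRelation
  (toggle_hypotheses_symmDiff)
open _root_.Literature.Probability.LatticeModels.DiscreteDobrushin (startCorner exitTime isStartCorner_startCorner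
  medialExploration_eq_explorationList isInnerFace_of_lt_exitTime not_isInnerFace_exitTime)

/-! ## The pair template for the arriving darts -/

section Orbit

variable {D : DiscreteDobrushin} {ω ω' : BondConfig (Site 2)} {c₀ p : Site 2 × Fin 4}

/-- **The arriving-dart pair template.** In the setting of `kval_case1` (`p = orb i₁` a dart of the exploration of `ω`,
its partner not; `ω'` the flip at `e = cTgt p`; the loop of the partner turns by `4 · turnSign`): the arriving dart
weights at `e` are `λ^C, 0` for `ω` and `λ^C, λ^{C+2s}` for `ω'` (`s = turnSign ω p`), so they add up to
`(2 + λ^{2s}) λ^C`. [cite: Zhou2024SLE6BondZ2, eq. (102)] -/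
theorem ival_case1 (hD : D.IsZdAdmissible) (hc₀ : D.IsStartCorner c₀)
    (hagree : ∀ e, e ≠ cTgt p → (e ∈ D.bcBondConfig ω' ↔ e ∈ D.bcBondConfig ω))
    (hdiff : ¬ (cTgt p ∈ D.bcBondConfig ω' ↔ cTgt p ∈ D.bcBondConfig ω))
    (hx : ∀ j, D.IsInnerFace (faceAt p.1 j)) (hy : ∀ j, D.IsInnerFace (faceAt (p.1 + cornerUnit (p.2 + 1)) j))
    {N P Q i₁ : ℕ} (hN : ¬ D.IsInnerFace (cFace (cornerOrbit (D.bcBondConfig ω) c₀ N)))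
    (hlt : ∀ k < N, D.IsInnerFace (cFace (cornerOrbit (D.bcBondConfig ω) c₀ k))) (hP0 : 0 < P)
    (hP : cornerOrbit (D.bcBondConfig ω) c₀ P = c₀)
    (hPmin : ∀ s, 0 < s → s < P → cornerOrbit (D.bcBondConfig ω) c₀ s ≠ c₀)
    (hQ0 : 0 < Q) (hQ : cornerOrbit (D.bcBondConfig ω) (cornerPartner p) Q = cornerPartner p)
    (hQmin : ∀ s, 0 < s → s < Q → cornerOrbit (D.bcBondConfig ω) (cornerPartner p) s ≠ cornerPartner p)
    (hi₁ : cornerOrbit (D.bcBondConfig ω) c₀ i₁ = p) (hi₁N : i₁ < N)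
    (h₂ : ∀ i < N, cornerOrbit (D.bcBondConfig ω) c₀ i ≠ cornerPartner p)
    (hS : ∑ m ∈ Finset.range Q, turnSign (D.bcBondConfig ω) (cornerOrbit (D.bcBondConfig ω) (cornerPartner p) m) =
      4 * turnSign (D.bcBondConfig ω) p) :
    (dartW (D.bcBondConfig ω) c₀ p N + dartW (D.bcBondConfig ω) c₀ (cornerPartner p) N) +
        (dartW (D.bcBondConfig ω') c₀ p (N + Q) + dartW (D.bcBondConfig ω') c₀ (cornerPartner p) (N + Q)) =
      (if turnSign (D.bcBondConfig ω) p = 1 then 2 + sixthPhase 1 * sixthPhase 1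
        else 2 + sixthPhase (-1) * sixthPhase (-1)) * sixthPhase (turnCount (D.bcBondConfig ω) c₀ i₁) := by
  classical
  set β := D.bcBondConfig ω
  set β' := D.bcBondConfig ω'
  set p₂ := cornerPartner p with hp₂
  have hinj : ∀ a b, a < N → b < N → cornerOrbit β c₀ a = cornerOrbit β c₀ b → a = b := by
    intro a b ha hb h
    by_contra hne
    rcases Nat.lt_or_gt_of_ne hne with hab | hab
    · exact cornerOrbit_ne hD hc₀ hab (fun k hk => hlt k (by omega)) h
    · exact cornerOrbit_ne hD hc₀ hab (fun k hk => hlt k (by omega)) h.symm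
  have hdisj : ∀ m s, cornerOrbit β p₂ m ≠ cornerOrbit β c₀ s := fun m s =>
    loop_ne_of_never_arrives hD hc₀ hy hN hlt hP0 hP hPmin h₂ m s
  obtain ⟨hpre, hloop, htail, -, -⟩ := cornerOrbit_toggle_case1 hD hc₀ hagree hdiff hx hy hN hlt hP0 hP hPmin hQ0 hQ
    hQmin hi₁ hi₁N h₂
  -- ### the arriving darts of `β` at `e`
  have uP : ∀ j < N, cornerOrbit β c₀ j = p ↔ j = i₁ := fun j hj =>
    ⟨fun h => hinj j i₁ hj hi₁N (h.trans hi₁.symm), fun h => h ▸ hi₁⟩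
  -- ### the arriving darts of `β'` at `e` (exit time `N + Q`)
  have hloopQ : cornerOrbit β' c₀ (i₁ + Q) = p₂ := by
    have := hloop (Q - 1) (by omega)
    rwa [show i₁ + 1 + (Q - 1) = i₁ + Q by omega, Nat.sub_add_cancel hQ0, hQ] at this
  have hcls : ∀ j < N + Q, (j ≤ i₁ ∧ cornerOrbit β' c₀ j = cornerOrbit β c₀ j) ∨
      (i₁ < j ∧ j ≤ i₁ + Q ∧ cornerOrbit β' c₀ j = cornerOrbit β p₂ (j - i₁)) ∨ (i₁ + Q < j ∧ cornerOrbit β' c₀ j = cornerOrbit β c₀ (j - Q)) := by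
    intro j hj
    by_cases hj1 : j ≤ i₁
    · exact Or.inl ⟨hj1, hpre j hj1⟩
    · by_cases hj2 : j ≤ i₁ + Q
      · refine Or.inr (Or.inl ⟨by omega, hj2, ?_⟩)
        have := hloop (j - i₁ - 1) (by omega)
        rwa [show i₁ + 1 + (j - i₁ - 1) = j by omega, show j - i₁ - 1 + 1 = j - i₁ by omega] at this
      · refine Or.inr (Or.inr ⟨by omega, ?_⟩)
        have := htail (j - i₁ - Q - 1) (by omega)
        rwa [show i₁ + Q + 1 + (j - i₁ - Q - 1) = j by omega, show i₁ + 1 + (j - i₁ - Q - 1) = j - Q by omega] at this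
  have uP' : ∀ j < N + Q, cornerOrbit β' c₀ j = p ↔ j = i₁ := by
    intro j hj
    refine ⟨fun h => ?_, fun h => by rw [h, hpre i₁ le_rfl, hi₁]⟩
    rcases hcls j hj with ⟨hj1, hoj⟩ | ⟨hj1, hj2, hoj⟩ | ⟨hj1, hoj⟩
    · exact (uP j (by omega)).1 (hoj ▸ h)
    · exact absurd ((hoj.symm.trans h).trans hi₁.symm) (hdisj _ _)
    · have := (uP (j - Q) (by omega)).1 (hoj ▸ h); omega
  have uP₂' : ∀ j < N + Q, cornerOrbit β' c₀ j = p₂ ↔ j = i₁ + Q := by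
    intro j hj
    refine ⟨fun h => ?_, fun h => h ▸ hloopQ⟩
    rcases hcls j hj with ⟨hj1, hoj⟩ | ⟨hj1, hj2, hoj⟩ | ⟨hj1, hoj⟩
    · exact absurd (hoj ▸ h) (h₂ j (by omega))
    · by_contra hne
      exact hQmin (j - i₁) (by omega) (by omega) (hoj.symm.trans h)
    · exact absurd (hoj ▸ h) (h₂ (j - Q) (by omega))
  -- ### turn counts
  set C := turnCount β c₀ i₁ with hC
  have htgt : ∀ j < N, j ≠ i₁ → cTgt (cornerOrbit β c₀ j) ≠ cTgt p := by
    intro j hj h1 h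
    rcases cTgt_eq_cTgt_iff.1 h with h | h
    · exact h1 (hinj j i₁ hj hi₁N (h.trans hi₁.symm))
    · exact h₂ j hj h
  have hC' : turnCount β' c₀ i₁ = C :=
    turnCount_congr_prefix hpre fun j hj => hagree _ (htgt j (by omega) (by omega))
  have hLtgt : ∀ m, 0 < m → m < Q → cTgt (cornerOrbit β p₂ m) ≠ cTgt p := by
    intro m hm hmQ h
    rcases cTgt_eq_cTgt_iff.1 h with h | h
    · exact hdisj m i₁ (h.trans hi₁.symm)
    · exact hQmin m hm hmQ h
  have hS1 : ∑ m ∈ Finset.range (Q - 1), turnSign β (cornerOrbit β p₂ (m + 1)) = 3 * turnSign β p := by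
    have h := hS
    rw [show Q = (Q - 1) + 1 by omega, Finset.sum_range_succ'] at h
    have h0 : turnSign β (cornerOrbit β p₂ 0) = turnSign β p := turnSign_partner β p
    rw [h0] at h; linear_combination h
  have hCQ' : turnCount β' c₀ (i₁ + Q) = C + turnSign β' p + 3 * turnSign β p := by
    rw [turnCount_add, show Q = (Q - 1) + 1 by omega, Finset.sum_range_succ', add_zero,
      hpre i₁ le_rfl, hi₁, hC', ← hS1]
    have hterm : ∀ m ∈ Finset.range (Q - 1),
        turnSign β' (cornerOrbit β' c₀ (i₁ + (m + 1))) = turnSign β (cornerOrbit β p₂ (m + 1)) := by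
      intro m hm
      rw [Finset.mem_range] at hm
      rw [show i₁ + (m + 1) = i₁ + 1 + m by omega, hloop m (by omega)]
      exact turnSign_congr (hagree _ (hLtgt (m + 1) (Nat.succ_pos _) (by omega)))
    rw [Finset.sum_congr rfl hterm]
    ring
  -- ### the weights
  have wP : dartW β c₀ p N = sixthPhase C := dartW_eq_single hi₁N uP
  have wP₂ : dartW β c₀ p₂ N = 0 := dartW_eq_zero h₂
  have wP' : dartW β' c₀ p (N + Q) = sixthPhase C := by rw [dartW_eq_single (by omega) uP', hC']
  have wP₂' : dartW β' c₀ p₂ (N + Q) = sixthPhase (C + turnSign β' p + 3 * turnSign β p) := by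
    rw [dartW_eq_single (by omega) uP₂', hCQ']
  -- ### the algebra, in the two cases `e` open / closed in `β`
  have he'iff : cTgt p ∈ β' ↔ cTgt p ∉ β := ⟨fun h' h => hdiff ⟨fun _ => h, fun _ => h'⟩,
    fun h => by_contra fun h' => hdiff ⟨fun h'' => absurd h'' h', fun h'' => absurd h'' h⟩⟩
  by_cases he : cTgt p ∈ β
  · -- `e` open in `β`: a right turn, `s = -1`
    have he' : cTgt p ∉ β' := fun h => (he'iff.1 h) he
    have hs : turnSign β p = -1 := turnSign_of_mem he
    have hs' : turnSign β' p = 1 := turnSign_of_not_mem he'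
    rw [hs, hs'] at wP₂'
    rw [if_neg (by rw [hs]; decide), wP, wP₂, wP', wP₂']
    have e3 : sixthPhase (C + 1 + 3 * -1) = sixthPhase C * (sixthPhase (-1) * sixthPhase (-1)) := by
      rw [← sixthPhase_add, ← sixthPhase_add]; congr 1; ring
    rw [e3]; ring
  · -- `e` closed in `β`: a left turn, `s = +1`
    have he' : cTgt p ∈ β' := he'iff.2 he
    have hs : turnSign β p = 1 := turnSign_of_not_mem he
    have hs' : turnSign β' p = -1 := turnSign_of_mem he'
    rw [hs, hs'] at wP₂'
    rw [if_pos hs, wP, wP₂, wP', wP₂']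
    have e3 : sixthPhase (C + -1 + 3 * 1) = sixthPhase C * (sixthPhase 1 * sixthPhase 1) := by
      rw [← sixthPhase_add, ← sixthPhase_add]; congr 1; ring
    rw [e3]; ring

end Orbit

/-! ## The pathwise pair identity from the once side -/

section Pathwise

variable {E : DiscreteDobrushin}

/-- **The arriving-dart pair identity from the once side**: `r = orb i₁` is a dart of the exploration of `ω`, its partner is
not, `ω'` is the flip at `e = cTgt r` (interior, hole-free inner faces); then the four arriving weights (two for `ω`, two for
`ω'`) add up to `(2 + λ²) · onceChiralPhase … true + (2 + λ̄²) · onceChiralPhase … false` read on `ω`, and the once-visit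
phases of `ω'` vanish. [cite: Zhou2024SLE6BondZ2, eq. (102)] -/
theorem ival_pair_of_once (hE : E.IsZdAdmissible) (hH : HoleFree {f : Site 2 | E.IsInnerFace f})
    {r : Site 2 × Fin 4}
    (hx : ∀ j, E.IsInnerFace (faceAt r.1 j)) (hy : ∀ j, E.IsInnerFace (faceAt (r.1 + cornerUnit (r.2 + 1)) j))
    {ω ω' : BondConfig (Site 2)}
    (hagree : ∀ e, e ≠ cTgt r → (e ∈ E.bcBondConfig ω' ↔ e ∈ E.bcBondConfig ω))
    (hdiff : ¬ (cTgt r ∈ E.bcBondConfig ω' ↔ cTgt r ∈ E.bcBondConfig ω)) {i₁ : ℕ}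
    (hi₁ : cornerOrbit (E.bcBondConfig ω) (startCorner hE) i₁ = r) (hi₁N : i₁ < exitTime hE ω)
    (h₂ : ∀ i < exitTime hE ω, cornerOrbit (E.bcBondConfig ω) (startCorner hE) i ≠ cornerPartner r)
    {δ : ℝ} (hδ : δ ≠ 0) :
    (dartW (E.bcBondConfig ω) (startCorner hE) r (exitTime hE ω) +
        dartW (E.bcBondConfig ω) (startCorner hE) (cornerPartner r) (exitTime hE ω)) +
        (dartW (E.bcBondConfig ω') (startCorner hE) r (exitTime hE ω') +
          dartW (E.bcBondConfig ω') (startCorner hE) (cornerPartner r) (exitTime hE ω')) =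
      ((2 + sixthPhase 1 * sixthPhase 1) *
          onceChiralPhase (explorationList (E.bcBondConfig ω) (startCorner hE) (exitTime hE ω)) δ (1 / 3) (cTgt r) true +
        (2 + sixthPhase (-1) * sixthPhase (-1)) *
          onceChiralPhase (explorationList (E.bcBondConfig ω) (startCorner hE) (exitTime hE ω)) δ (1 / 3) (cTgt r) false) ∧
    ∀ b, onceChiralPhase (explorationList (E.bcBondConfig ω') (startCorner hE) (exitTime hE ω')) δ (1 / 3)
      (cTgt r) b = 0 := by
  have hc₀ := isStartCorner_startCorner hE
  have hN := not_isInnerFace_exitTime hE ω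
  have hlt : ∀ k < exitTime hE ω, E.IsInnerFace (cFace (cornerOrbit (E.bcBondConfig ω) (startCorner hE) k)) :=
    fun k hk => isInnerFace_of_lt_exitTime hE ω hk
  have hc₀m : (startCorner hE).1 ∈ meshDomain E.Ω E.δ :=
    E.zdBoundary_subset_meshDomain (E.zdArcA_subset_zdBoundary hc₀.mem_zdArcA)
  obtain ⟨P, hP0, hP, hPmin⟩ := exists_min_period hE ω hc₀m
  have hym : (cornerPartner r).1 ∈ meshDomain E.Ω E.δ :=
    fst_mem_meshDomain_of_isInnerFace (q := cornerPartner r) (hy _)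
  obtain ⟨Q, hQ0, hQ, hQmin⟩ := exists_min_period hE ω hym
  obtain ⟨hpre, hloop, -, hin', hout'⟩ := cornerOrbit_toggle_case1 hE hc₀ hagree hdiff hx hy hN hlt hP0 hP hPmin
    hQ0 hQ hQmin hi₁ hi₁N h₂
  have hN' : exitTime hE ω' = exitTime hE ω + Q := exitTime_eq_of hE ω' hout' hin'
  have hLin : ∀ m, E.IsInnerFace (cFace (cornerOrbit (E.bcBondConfig ω) (cornerPartner r) m)) := by
    intro m
    rw [← cornerOrbit_mod_period hQ m]
    rcases Nat.eq_zero_or_pos (m % Q) with h0 | hpos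
    · rw [h0]; exact (hy _ : E.IsInnerFace (cFace (cornerPartner r)))
    · obtain ⟨j, hj⟩ : ∃ j, m % Q = j + 1 := ⟨m % Q - 1, by omega⟩
      have hjQ : j + 1 ≤ Q := by have := Nat.mod_lt m hQ0; omega
      rw [hj, ← hloop j hjQ]
      exact hin' _ (by omega)
  have hdisj : ∀ m i, i < exitTime hE ω →
      cornerOrbit (E.bcBondConfig ω) (cornerPartner r) m ≠ cornerOrbit (E.bcBondConfig ω) (startCorner hE) i :=
    fun m i _ => loop_ne_of_never_arrives hE hc₀ hy hN hlt hP0 hP hPmin h₂ m i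
  have hS := loopTurn_eq hH hc₀ hx hN hQ0 hQ hQmin hLin hdisj hi₁ hi₁N
  have hpair := ival_case1 hE hc₀ hagree hdiff hx hy hN hlt hP0 hP hPmin hQ0 hQ hQmin hi₁ hi₁N h₂ hS
  have hi₁N' : i₁ + 1 < exitTime hE ω := succ_lt_of_arrives hN hx hi₁ hi₁N
  have uP : ∀ j < exitTime hE ω, cornerOrbit (E.bcBondConfig ω) (startCorner hE) j = r → j = i₁ := by
    intro j hj h
    by_contra hne
    rcases Nat.lt_or_gt_of_ne hne with hab | hab
    · exact cornerOrbit_ne hE hc₀ hab (fun k hk => hlt k (by omega)) (h.trans hi₁.symm)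
    · exact cornerOrbit_ne hE hc₀ hab (fun k hk => hlt k (by omega)) (hi₁.trans h.symm)
  have hloopQ : cornerOrbit (E.bcBondConfig ω') (startCorner hE) (i₁ + Q) = cornerPartner r := by
    have := hloop (Q - 1) (by omega)
    rwa [show i₁ + 1 + (Q - 1) = i₁ + Q by omega, Nat.sub_add_cancel hQ0, hQ] at this
  rw [hN']
  refine ⟨?_, fun b => onceChiralPhase_explorationList_twice (by omega : i₁ ≠ i₁ + Q) ((hpre i₁ le_rfl).trans hi₁)
    (by omega) hloopQ (by omega) b⟩
  rw [hpair, onceChiralPhase_explorationList_once hδ hi₁ hi₁N' uP h₂ true,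
    onceChiralPhase_explorationList_once hδ hi₁ hi₁N' uP h₂ false]
  by_cases he : cTgt r ∈ E.bcBondConfig ω
  · simp [he, turnSign_of_mem he]
  · simp [he, turnSign_of_not_mem he]

end Pathwise

/-- **Registered one-line form of the arriving-dart pair template** `ival_case1` (helper of the node-template identities,
line `Sketch` of stmt-CriticalPhenomena-11292). [cite: Zhou2024SLE6BondZ2, eq. (102)] -/
theorem stub_inTemplatePairing : ∀ (D : DiscreteDobrushin) (ω ω' : BondConfig (Site 2)) (c₀ p : Site 2 × Fin 4) (N P Q i₁ : ℕ), D.IsZdAdmissible → D.IsStartCorner c₀ → (∀ e, e ≠ cTgt p → (e ∈ D.bcBondConfig ω' ↔ e ∈ D.bcBondConfig ω)) → ¬ (cTgt p ∈ D.bcBondConfig ω' ↔ cTgt p ∈ D.bcBondConfig ω) → (∀ j, D.IsInnerFace (faceAt p.1 j)) → (∀ j, D.IsInnerFace (faceAt (p.1 + cornerUnit (p.2 + 1)) j)) → ¬ D.IsInnerFace (cFace (cornerOrbit (D.bcBondConfig ω) c₀ N)) → (∀ k < N, D.IsInnerFace (cFace (cornerOrbit (D.bcBondConfig ω) c₀ k)))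 → 0 < P → cornerOrbit (D.bcBondConfig ω) c₀ P = c₀ → (∀ s, 0 < s → s < P → cornerOrbit (D.bcBondConfig ω) c₀ s ≠ c₀) → 0 < Q → cornerOrbit (D.bcBondConfig ω) (cornerPartner p) Q = cornerPartner p → (∀ s, 0 < s → s < Q → cornerOrbit (D.bcBondConfig ω) (cornerPartner p) s ≠ cornerPartner p) → cornerOrbit (D.bcBondConfig ω) c₀ i₁ = p → i₁ < N → (∀ i < N, cornerOrbit (D.bcBondConfig ω) c₀ i ≠ cornerPartner p) → ∑ m ∈ Finset.range Q, turnSign (D.bcBondConfig ω) (cornerOrbit (D.bcBondConfig ω) (cornerPartner p) m) = 4 * turnSign (D.bcBondConfig ω) p → (Summit.CriticalPhenomena.CardyFormulaZ2.Theorems.ParafermionFamiliesToSLESix.StripAnchored.S2.dartW (D.bcBondConfig ω) c₀ p N + Summit.CriticalPhenomena.CardyFormulaZ2.Theorems.ParafermionFamiliesToSLESix.StripAnchored.S2.dartW (D.bcBondConfig ω) c₀ (cornerPartner p) N) + (Summit.CriticalPhenomena.CardyFormulaZ2.Theorems.ParafermionFamiliesToSLESix.StripAnchored.S2.dartW (D.bcBondConfig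 ω') c₀ p (N + Q) + Summit.CriticalPhenomena.CardyFormulaZ2.Theorems.ParafermionFamiliesToSLESix.StripAnchored.S2.dartW (D.bcBondConfig ω') c₀ (cornerPartner p) (N + Q)) = (if turnSign (D.bcBondConfig ω) p = 1 then 2 + Summit.CriticalPhenomena.CardyFormulaZ2.Theorems.ParafermionFamiliesToSLESix.StripAnchored.S2.sixthPhase 1 * Summit.CriticalPhenomena.CardyFormulaZ2.Theorems.ParafermionFamiliesToSLESix.StripAnchored.S2.sixthPhase 1 else 2 + Summit.CriticalPhenomena.CardyFormulaZ2.Theorems.ParafermionFamiliesToSLESix.StripAnchored.S2.sixthPhase (-1) * Summit.CriticalPhenomena.CardyFormulaZ2.Theorems.ParafermionFamiliesToSLESix.StripAnchored.S2.sixthPhase (-1)) * Summit.CriticalPhenomena.CardyFormulaZ2.Theorems.ParafermionFamiliesToSLESix.StripAnchored.S2.sixthPhase (turnCount (D.bcBondConfig ω) c₀ i₁) :=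
  fun _ _ _ _ _ _ _ _ _ hD hc₀ hagree hdiff hx hy hN hlt hP0 hP hPmin hQ0 hQ hQmin hi₁ hi₁N h₂ hS =>
    ival_case1 hD hc₀ hagree hdiff hx hy hN hlt hP0 hP hPmin hQ0 hQ hQmin hi₁ hi₁N h₂ hS

end Summit.CriticalPhenomena.CardyFormulaZ2.Theorems.WeakHolomorphy.SplitBypass

end
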